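import Mathlib
import Summits.Langlands.Langlands.Theses.QuadraticWindow
import Literature.NumberTheory.Automorphic.GaloisActionPlaces
import Literature.NumberTheory.GaloisRepresentations.ContinuousRep
import Literature.NumberTheory.GaloisRepresentations.FramedRepTwist
import Summits.Langlands.Langlands.Theorems.TwistUnpackaging.Negative.TwistSeparationOrder
import Summits.Langlands.Langlands.Theorems.TwistUnpackaging.Negative.ControlLoadBearing

/-!
# Line `twist-annihilator-krull-schmidt` for the crux `QuadraticWindow.TwistUnpackaging`
(stmt-Langlands-10903; crux-plan, round 1).

Skeleton: six registered stubs `stub_*` (their precise statements are the `def S.stub_* : Prop`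
next to them) and the kernel-checked composition
`TwistUnpackaging_of : S.stub_auxiliaryTwist → … → S.stub_separation → TwistUnpackaging`,
`TwistUnpackaging_proof : TwistUnpackaging`.  Everything is stated over existing declarations;
the small vocabulary below (`HasValues`, `UnramifiedAboveL`, `ParityCompatible`, `Robust`,
`Admissible`, `IsPackage`, `Good`, `SplitsAt`, `TauLinked`) only abbreviates sub-clauses of the
crux (`Admissible`/`IsPackage` are its family hypothesis and conclusion verbatim).
The two abstract cores the stubs are proved from are recorded as `TwistCancellation`
(the lever, mass form) and `SingleTwistUnscrewing` (documentation, not stubs).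
-/

namespace Summit.Langlands.Langlands.Cruxes.TwistUnpackaging.TwistAnnihilatorKrullSchmidt

set_option linter.dupNamespace false

open scoped NumberField Polynomial
open IsDedekindDomain Filter
open Literature.NumberTheory.GaloisRepresentations Literature.NumberTheory.Automorphic

noncomputable section

/-! ## Vocabulary (abbreviations of sub-clauses of the crux) -/

section Vocabulary

variable {F₀ F : Type} [Field F₀] [NumberField F₀] [Field F] [NumberField F] [Algebra F₀ F]

/-- The Artin avatar `e : Γ_F → GL₁(ℂ)` is unramified off `S` with arithmetic-Frobenius value `c w`
at every `w ∉ S`. -/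
def HasValues (e : FramedGaloisRep F ℂ 1) (S : Set (HeightOneSpectrum (𝓞 F)))
    (c : HeightOneSpectrum (𝓞 F) → ℂ) : Prop :=
  ∀ w ∉ S, e.IsUnramifiedAt w ∧ e.HasFrobCharpolyAt w (Polynomial.X - Polynomial.C (c w))

/-- First admissibility clause of the crux family: unramified above `ℓ`. -/
def UnramifiedAboveL (ℓ : ℕ) (e : FramedGaloisRep F ℂ 1) : Prop :=
  ∀ w : HeightOneSpectrum (𝓞 F), ((ℓ : ℕ) : 𝓞 F) ∈ w.asIdeal → e.IsUnramifiedAt w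

/-- Second admissibility clause of the crux family: `ψ_w(-1) = ψ_{τw}(-1)` at the real places. -/
def ParityCompatible (τ : F ≃ₐ[F₀] F) (e : FramedGaloisRep F ℂ 1) : Prop :=
  ∀ (φ : F →+* ℝ) (c c' : Field.absoluteGaloisGroup F), IsComplexConjugation φ c →
    IsComplexConjugation (φ.comp (τ : F →+* F)) c' →
      Matrix.GeneralLinearGroup.det (e c) = Matrix.GeneralLinearGroup.det (e c')

variable {n : ℕ} {hcpt : isCompact_glFiniteIntegralLevel n F}

/-- Third admissibility clause of the crux family: `π ⊗ ψ` is robustly not `τ`-invariant. -/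
def Robust (τ : F ≃ₐ[F₀] F) (π : CuspidalAutomorphicRepData n F hcpt) (e : FramedGaloisRep F ℂ 1) :
    Prop :=
  ∃ᶠ w in cofinite, ∃ (α β : Multiset ℂ) (c c' : ℂ), π.1.HasSatakeParamAt w α ∧
    π.1.HasSatakeParamAt (τ • w) β ∧ e.HasFrobCharpolyAt w (Polynomial.X - Polynomial.C c) ∧
      e.HasFrobCharpolyAt (τ • w) (Polynomial.X - Polynomial.C c') ∧ β.map (fun b ↦ b * c') ≠ α.map (fun a ↦ a * c)

/-- Admissibility of an Artin avatar = the three hypotheses of the crux's family clause. -/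
def Admissible (τ : F ≃ₐ[F₀] F) (π : CuspidalAutomorphicRepData n F hcpt) (ℓ : ℕ)
    (e : FramedGaloisRep F ℂ 1) : Prop :=
  UnramifiedAboveL ℓ e ∧ ParityCompatible τ e ∧ Robust τ π e

/-- `R` is the induced package of `eψ` = the conclusion of the crux's family clause, verbatim:
semisimple, and at every `v ∤ ℓ` all of whose primes `w` in `F` are unramified over `F₀` with `π`
unramified and `eψ` unramified of value `c w`, unramified with characteristic polynomial
`∏_{w ∣ v} P_w[c_w](X^{f(w|v)})`. -/
def IsPackage (π : CuspidalAutomorphicRepData n F hcpt) {ℓ : ℕ} [Fact ℓ.Prime]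
    (ι : PadicAlgCl ℓ ≃+* ℂ) (eψ : FramedGaloisRep F ℂ 1)
    (R : FramedGaloisRep F₀ (PadicAlgCl ℓ) (2 * n)) : Prop :=
  R.toGaloisRep.IsSemisimple ∧
    ∀ (v : HeightOneSpectrum (𝓞 F₀)) (α : HeightOneSpectrum (𝓞 F) → Multiset ℂ)
      (c : HeightOneSpectrum (𝓞 F) → ℂ), ((ℓ : ℕ) : 𝓞 F₀) ∉ v.asIdeal →
      (∀ w : HeightOneSpectrum (𝓞 F), w.under (𝓞 F₀) = v →
        w.asIdeal.ramificationIdx (𝓞 F₀) = 1 ∧ π.1.HasSatakeParamAt w (α w) ∧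
          eψ.IsUnramifiedAt w ∧ eψ.HasFrobCharpolyAt w (Polynomial.X - Polynomial.C (c w))) →
      R.IsUnramifiedAt v ∧ R.HasFrobCharpolyAt v
        (∏ᶠ w ∈ {w : HeightOneSpectrum (𝓞 F) | w.under (𝓞 F₀) = v},
          Polynomial.expand (PadicAlgCl ℓ) (w.asIdeal.inertiaDeg (𝓞 F₀))
            (arithFrobPolyOfSatake ι w.residueCard n ((α w).map (fun a ↦ a * c w))))

/-- A place `w` of `F` is GOOD for the exceptional set `S`: `w, τw ∉ S`, `w ∤ ℓ`, `w` unramified over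
`F₀`, `π` unramified at `w` and `τw`.  All but finitely many places are good. -/
def Good (τ : F ≃ₐ[F₀] F) (π : CuspidalAutomorphicRepData n F hcpt) (ℓ : ℕ)
    (S : Set (HeightOneSpectrum (𝓞 F))) (w : HeightOneSpectrum (𝓞 F)) : Prop :=
  w ∉ S ∧ τ • w ∉ S ∧ ((ℓ : ℕ) : 𝓞 F) ∉ w.asIdeal ∧ w.asIdeal.ramificationIdx (𝓞 F₀) = 1 ∧
    π.1.IsUnramifiedAt w ∧ π.1.IsUnramifiedAt (τ • w)

/-- `(ρ, ρ')` SPLITS the `ζ`-twisted package at `w`: the Frobenius roots of `ρ` at `w` together with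
`ζ ·` those of `ρ'` are `roots P_w ⊔ ζ · roots P_{τw}` (`P_w` = the predicted polynomial of the Satake
parameter at `w`).  With `ζ = 1` this is "`A ≅ ρ ⊕ ρ'` at `w`"; with `ζ = χ_ψ(Frob_w)` it is
"`C_ψ ≅ ρ ⊕ ρ'χ_ψ` at `w`". -/
def SplitsAt (τ : F ≃ₐ[F₀] F) (π : CuspidalAutomorphicRepData n F hcpt) {ℓ : ℕ} [Fact ℓ.Prime]
    (ι : PadicAlgCl ℓ ≃+* ℂ) (ρ ρ' : FramedGaloisRep F (PadicAlgCl ℓ) n)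
    (w : HeightOneSpectrum (𝓞 F)) (ζ : PadicAlgCl ℓ) : Prop :=
  ∃ P Q : Polynomial (PadicAlgCl ℓ), ρ.HasFrobCharpolyAt w P ∧ ρ'.HasFrobCharpolyAt w Q ∧
    ∀ α β : Multiset ℂ, π.1.HasSatakeParamAt w α → π.1.HasSatakeParamAt (τ • w) β →
      P.roots + Q.roots.map (fun x ↦ x * ζ) =
        (arithFrobPolyOfSatake ι w.residueCard n α).roots +
          (arithFrobPolyOfSatake ι (τ • w).residueCard n β).roots.map (fun x ↦ x * ζ)

/-- `ρ'` has at `w` the Frobenius characteristic polynomial that `ρ` has at `τw` ("`ρ' ≅ ρ^τ` at `w`"). -/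
def TauLinked (τ : F ≃ₐ[F₀] F) {ℓ : ℕ} [Fact ℓ.Prime] (ρ ρ' : FramedGaloisRep F (PadicAlgCl ℓ) n)
    (w : HeightOneSpectrum (𝓞 F)) : Prop :=
  ∀ P : Polynomial (PadicAlgCl ℓ), ρ.HasFrobCharpolyAt (τ • w) P → ρ'.HasFrobCharpolyAt w P

end Vocabulary

/-! ## The six stubs -/

/-- STUB 1 (DETECTION, global; class field theory).  For `F/F₀` quadratic with `τ ≠ 1`, every prime
`ℓ` and every bound `N` there are a prime `p > N`, a finite `τ`-stable set `S` of places, values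
`c : places → μ_p` and Artin avatars `θ j : Γ_F → GL₁(ℂ)` (`j ∈ ℕ`; the powers of ONE character
`θ` of order `p`) such that: `θ j` is unramified above `ℓ`, parity-compatible, unramified off `S`
with Frobenius value `(c w)^j` at `w ∉ S`, and `χ := θ/θ^τ` is non-trivial (`c w ≠ c (τw)`
at infinitely many `w`).  Sources: ray-class characters of prime order `p` and conductor a single
auxiliary prime `𝔮 ∤ ℓ` with `𝔮 ≠ τ𝔮` (Kummer–Chebotarev), tree: `HeckeCharacter.exists_of_isRayClassCharacter`,
`HeckeCharacter.exists_framedArtinRep_of_isFiniteOrder` (proved); odd order ⇒ parity automatic. -/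
def S.stub_auxiliaryTwist : Prop :=
  ∀ (F₀ F : Type) [Field F₀] [NumberField F₀] [Field F] [NumberField F] [Algebra F₀ F]
    (τ : F ≃ₐ[F₀] F), Module.finrank F₀ F = 2 → τ ≠ 1 → ∀ (ℓ : ℕ) [Fact ℓ.Prime] (N : ℕ),
    ∃ p : ℕ, p.Prime ∧ N < p ∧
      ∃ (S : Set (HeightOneSpectrum (𝓞 F))) (c : HeightOneSpectrum (𝓞 F) → ℂ)
        (θ : ℕ → FramedGaloisRep F ℂ 1),
        S.Finite ∧ (∀ w, τ • w ∈ S ↔ w ∈ S) ∧ (∀ w ∉ S, c w ^ p = 1) ∧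
          (∃ᶠ w in cofinite, c w ≠ c (τ • w)) ∧
          ∀ j : ℕ, HasValues (θ j) S (fun w ↦ c w ^ j) ∧ UnramifiedAboveL ℓ (θ j) ∧
            ParityCompatible τ (θ j)

/-- STUB 2 (admissibility of the powers; pigeonhole on Satake multisets).  If `π` is not
`τ`-invariant (frequently `Sat(π, τw) ≠ Sat(π, w)`), `p > n` is prime and `θ j` are as in stub 1,
then all but at most ONE residue class of exponents `j mod p` give a robustly non-`τ`-invariant
`π ⊗ θ^j`; the class of `0` is good.  (Two bad residues `j₁ ≢ j₂` force `α_w = α_w · ζ^{j₁-j₂}`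
with `ord ζ = p > n = card α_w`, `0 ∉ α_w` — `hasSatakeParamAt_ne_zero_holds`,
`hasSatakeParamAt_cofinite_holds`.) -/
def S.stub_powerAdmissibility : Prop :=
  ∀ (F₀ F : Type) [Field F₀] [NumberField F₀] [Field F] [NumberField F] [Algebra F₀ F]
    (τ : F ≃ₐ[F₀] F) (n : ℕ) (hcpt : isCompact_glFiniteIntegralLevel n F)
    (π : CuspidalAutomorphicRepData n F hcpt),
    (∃ᶠ w in cofinite, ∃ α β : Multiset ℂ,
      π.1.HasSatakeParamAt w α ∧ π.1.HasSatakeParamAt (τ • w) β ∧ β ≠ α) →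
    ∀ (p : ℕ), p.Prime → n < p →
    ∀ (S : Set (HeightOneSpectrum (𝓞 F))) (c : HeightOneSpectrum (𝓞 F) → ℂ)
      (θ : ℕ → FramedGaloisRep F ℂ 1), S.Finite → (∀ w, τ • w ∈ S ↔ w ∈ S) →
      (∀ w ∉ S, c w ^ p = 1) → (∃ᶠ w in cofinite, c w ≠ c (τ • w)) →
      (∀ j : ℕ, HasValues (θ j) S (fun w ↦ c w ^ j)) →
    ∃ j₀ : ℕ, ¬ p ∣ j₀ ∧ ∀ j : ℕ, j % p ≠ j₀ % p → Robust τ π (θ j)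

/-- STUB 3 (EXISTENCE — single-character unscrewing, the Krull–Schmidt step; abstract core
`SingleTwistUnscrewing`).  From the packages `R_j` of the powers `θ^j` (all exponents off one
residue class `j₀ ≢ 0`), `p > 8n²+6`: there are an exponent `0 < k < p` and semisimple
`ρ, ρ' : Γ_F → GL_n(ℚ̄_ℓ)` such that at EVERY good place `w`: `ρ, ρ'` are unramified, `ρ'` carries at `w`
the polynomial of `ρ` at `τw`, `A := R_0|Γ_F ≅ ρ ⊕ ρ'` and `C_k := R_k|Γ_F ⊗ θ̃^k ≅ ρ ⊕ ρ'χ₀`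
(`χ₀ := (θ̃/θ̃^τ)^k`), both read on Frobenius roots (`SplitsAt … 1`, `SplitsAt … χ₀(Frob_w)`).
Why true: Brauer–Nesbitt identities `C_k ⊕ C_{-k}χ₀ ≅ Aχ₀ ⊕ A`, `C_k ⊕ C_kχ₀ ≅ Aχ₀ ⊕ C_{2k}` in the
Grothendieck group, genericity of `χ₀, χ₀²` w.r.t. the ≤ 4n² bad characters of `A` (counting:
`p - 1 > 8n² + 4`), layer separation, dimension pinning at one Frobenius with `χ₀ ≠ 1`, and
`A^τ ≅ A`, `C_k^τ ≅ C_kχ₀⁻¹` for `ρ' ≅ ρ^τ`; no irreducibility, no pseudocharacters. -/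
def S.stub_unscrewing : Prop :=
  ∀ (F₀ F : Type) [Field F₀] [NumberField F₀] [Field F] [NumberField F] [Algebra F₀ F]
    (τ : F ≃ₐ[F₀] F), Module.finrank F₀ F = 2 → τ ≠ 1 →
    ∀ (n : ℕ) (hcpt : isCompact_glFiniteIntegralLevel n F) (π : CuspidalAutomorphicRepData n F hcpt)
      (ℓ : ℕ) [Fact ℓ.Prime] (ι : PadicAlgCl ℓ ≃+* ℂ) (p : ℕ), p.Prime → 8 * n ^ 2 + 6 < p →
    ∀ (S : Set (HeightOneSpectrum (𝓞 F))) (c : HeightOneSpectrum (𝓞 F) → ℂ)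
      (θ : ℕ → FramedGaloisRep F ℂ 1) (j₀ : ℕ), S.Finite → (∀ w, τ • w ∈ S ↔ w ∈ S) →
      (∀ w ∉ S, c w ^ p = 1) → (∃ᶠ w in cofinite, c w ≠ c (τ • w)) →
      (∀ j : ℕ, HasValues (θ j) S (fun w ↦ c w ^ j)) → ¬ p ∣ j₀ →
      (∀ j : ℕ, j % p ≠ j₀ % p →
        ∃ R : FramedGaloisRep F₀ (PadicAlgCl ℓ) (2 * n), IsPackage π ι (θ j) R) →
    ∃ (k : ℕ) (ρ ρ' : FramedGaloisRep F (PadicAlgCl ℓ) n), 0 < k ∧ k < p ∧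
      ρ.toGaloisRep.IsSemisimple ∧ ρ'.toGaloisRep.IsSemisimple ∧
      ∀ w, Good τ π ℓ S w →
        ρ.IsUnramifiedAt w ∧ ρ'.IsUnramifiedAt w ∧ TauLinked τ ρ ρ' w ∧
          SplitsAt τ π ι ρ ρ' w 1 ∧ SplitsAt τ π ι ρ ρ' w ((ι.symm (c w / c (τ • w))) ^ k)

/-- STUB 4 (COHERENCE — the twist annihilator; abstract core `TwistCancellation`).  With `ρ, ρ'` as
produced by stub 3 (`A ≅ ρ ⊕ ρ'`, `C_k ≅ ρ ⊕ ρ'χ₀` at every good place, `ord χ₀ = p > 2n`), for ANY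
avatar `eψ` (values `d` off `Sψ`) such that both `ψ` and `ψθ^k` (avatar `eψθ`, values `d · c^k`) have
packages `Rψ, Rψθ`: `C_ψ ≅ ρ ⊕ ρ'χ_ψ` at every good place, i.e. `SplitsAt … (χ_ψ(Frob_w))`.
Why true: the Brauer–Nesbitt identities `C_ψ ⊕ C_kχ_ψ ≅ Aχ_ψ ⊕ C_{ψθ^k}` and
`C_k ⊕ C_ψχ₀ ≅ Aχ₀ ⊕ C_{ψθ^k}` give `C_ψ ⊕ (ρ ⊕ ρ'χ_ψ)χ₀ ≅ C_ψχ₀ ⊕ (ρ ⊕ ρ'χ_ψ)` as genuine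
representations, and the mass-form cancellation (`TwistCancellation`, dimension `2n < p = ord χ₀`)
forces `C_ψ ≅ ρ ⊕ ρ'χ_ψ`.  (The signed-dimension form of cancellation is false — CancelToy — and is
not used.) -/
def S.stub_coherence : Prop :=
  ∀ (F₀ F : Type) [Field F₀] [NumberField F₀] [Field F] [NumberField F] [Algebra F₀ F]
    (τ : F ≃ₐ[F₀] F), Module.finrank F₀ F = 2 → τ ≠ 1 →
    ∀ (n : ℕ) (hcpt : isCompact_glFiniteIntegralLevel n F) (π : CuspidalAutomorphicRepData n F hcpt)
      (ℓ : ℕ) [Fact ℓ.Prime] (ι : PadicAlgCl ℓ ≃+* ℂ) (p : ℕ), p.Prime → 2 * n < p →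
    ∀ (S : Set (HeightOneSpectrum (𝓞 F))) (c : HeightOneSpectrum (𝓞 F) → ℂ) (k : ℕ)
      (θk : FramedGaloisRep F ℂ 1), S.Finite → (∀ w, τ • w ∈ S ↔ w ∈ S) →
      (∀ w ∉ S, c w ^ p = 1) → (∃ᶠ w in cofinite, c w ≠ c (τ • w)) → 0 < k → k < p →
      HasValues θk S (fun w ↦ c w ^ k) →
    ∀ (ρ ρ' : FramedGaloisRep F (PadicAlgCl ℓ) n), ρ.toGaloisRep.IsSemisimple →
      ρ'.toGaloisRep.IsSemisimple →
      (∀ w, Good τ π ℓ S w → ρ.IsUnramifiedAt w ∧ ρ'.IsUnramifiedAt w ∧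
        SplitsAt τ π ι ρ ρ' w 1 ∧ SplitsAt τ π ι ρ ρ' w ((ι.symm (c w / c (τ • w))) ^ k)) →
    ∀ (eψ eψθ : FramedGaloisRep F ℂ 1) (Sψ : Set (HeightOneSpectrum (𝓞 F)))
      (d : HeightOneSpectrum (𝓞 F) → ℂ) (Rψ Rψθ : FramedGaloisRep F₀ (PadicAlgCl ℓ) (2 * n)),
      Sψ.Finite → (∀ w, τ • w ∈ Sψ ↔ w ∈ Sψ) → HasValues eψ Sψ d →
      HasValues eψθ (S ∪ Sψ) (fun w ↦ d w * c w ^ k) →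
      IsPackage π ι eψ Rψ → IsPackage π ι eψθ Rψθ →
    ∀ w, Good τ π ℓ (S ∪ Sψ) w → SplitsAt τ π ι ρ ρ' w (ι.symm (d w / d (τ • w)))

/-- STUB 5 (DETECTION, per place; class field theory + the pigeonhole of stub 2 twice).  Given the
shift avatar `θk` (values `cθ ≠ 0` off `S`, unramified above `ℓ`, parity-compatible) and `π` not
`τ`-invariant: for all but finitely many places `w₀` with `τw₀ ≠ w₀` there is an avatar `eψ` of odd
prime order `r > n` (conductor one auxiliary prime `∤ ℓ`, away from `w₀, τw₀`), values `d` off a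
finite `τ`-stable `Sψ ∌ w₀, τw₀`, with `d(w₀)/d(τw₀)` of order `> n`, such that BOTH `ψ` and `ψθ^k`
(avatar `eψθ`, values `d·cθ` off `S ∪ Sψ`) are admissible for the crux family.  Sources: as stub 1
(Kummer–Chebotarev prime forcing `r ∣ ord[w₀/τw₀]` in `Cl_𝔮`; or the CFT-free Kummer descent of
idea `kummer-descent-detection`); admissibility by the pigeonhole over `ψ^i`, `ψ^iθ^k`. -/
def S.stub_separatingTwists : Prop :=
  ∀ (F₀ F : Type) [Field F₀] [NumberField F₀] [Field F] [NumberField F] [Algebra F₀ F]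
    (τ : F ≃ₐ[F₀] F), Module.finrank F₀ F = 2 → τ ≠ 1 →
    ∀ (n : ℕ) (hcpt : isCompact_glFiniteIntegralLevel n F) (π : CuspidalAutomorphicRepData n F hcpt),
    (∃ᶠ w in cofinite, ∃ α β : Multiset ℂ,
      π.1.HasSatakeParamAt w α ∧ π.1.HasSatakeParamAt (τ • w) β ∧ β ≠ α) →
    ∀ (ℓ : ℕ) [Fact ℓ.Prime] (S : Set (HeightOneSpectrum (𝓞 F)))
      (cθ : HeightOneSpectrum (𝓞 F) → ℂ) (θk : FramedGaloisRep F ℂ 1),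
      S.Finite → (∀ w, τ • w ∈ S ↔ w ∈ S) → (∀ w ∉ S, cθ w ≠ 0) → HasValues θk S cθ → UnramifiedAboveL ℓ θk → ParityCompatible τ θk →
    ∀ᶠ w₀ in cofinite, τ • w₀ ≠ w₀ →
      ∃ (eψ eψθ : FramedGaloisRep F ℂ 1) (Sψ : Set (HeightOneSpectrum (𝓞 F)))
        (d : HeightOneSpectrum (𝓞 F) → ℂ),
        Sψ.Finite ∧ (∀ w, τ • w ∈ Sψ ↔ w ∈ Sψ) ∧ w₀ ∉ Sψ ∧ τ • w₀ ∉ Sψ ∧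
          HasValues eψ Sψ d ∧ HasValues eψθ (S ∪ Sψ) (fun w ↦ d w * cθ w) ∧
          Admissible τ π ℓ eψ ∧ Admissible τ π ℓ eψθ ∧ n < orderOf (d w₀ / d (τ • w₀))

/-- STUB 6 (SEPARATION and descent to the crux's matching; Mok Prop. 5.13 for all `n`).  If
`A ≅ ρ ⊕ ρ'` and `ρ' ≅ ρ^τ` at every good place, and at all but finitely many split places `w`
some twist of ratio `ζ_w` of order `> n` is split coherently by `(ρ, ρ')`, then `ρ` is unramified
with `charpoly ρ(Frob_w) = P_w` at all but finitely many `w`.  Why true: at a split `w`,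
`X ⊔ Y = P ⊔ Q` and `X ⊔ ζY = P ⊔ ζQ` with `ord ζ > n = |X|` force `X = P` (orbit argument; sharp,
cdisprove `separates_iff`); at an inert `w`, `Y = X` (`TauLinked`) and `X ⊔ X = P ⊔ P`; good places
are cofinite (finitely many ramified / over `ℓ` / in `S`; `hasSatakeParamAt_cofinite_holds`). -/
def S.stub_separation : Prop :=
  ∀ (F₀ F : Type) [Field F₀] [NumberField F₀] [Field F] [NumberField F] [Algebra F₀ F]
    (τ : F ≃ₐ[F₀] F), Module.finrank F₀ F = 2 → τ ≠ 1 →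
    ∀ (n : ℕ) (hcpt : isCompact_glFiniteIntegralLevel n F) (π : CuspidalAutomorphicRepData n F hcpt)
      (ℓ : ℕ) [Fact ℓ.Prime] (ι : PadicAlgCl ℓ ≃+* ℂ) (S : Set (HeightOneSpectrum (𝓞 F))), S.Finite →
    ∀ (ρ ρ' : FramedGaloisRep F (PadicAlgCl ℓ) n),
      (∀ w, Good τ π ℓ S w → ρ.IsUnramifiedAt w ∧ TauLinked τ ρ ρ' w ∧ SplitsAt τ π ι ρ ρ' w 1) →
      (∀ᶠ w in cofinite, τ • w ≠ w → Good τ π ℓ S w →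
        ∃ ζ : PadicAlgCl ℓ, n < orderOf ζ ∧ SplitsAt τ π ι ρ ρ' w ζ) →
    ∀ᶠ w in cofinite, ∀ α : Multiset ℂ, π.1.HasSatakeParamAt w α →
      ρ.IsUnramifiedAt w ∧ ρ.HasFrobCharpolyAt w (arithFrobPolyOfSatake ι w.residueCard n α)

theorem stub_auxiliaryTwist : S.stub_auxiliaryTwist := by
  sorry

theorem stub_powerAdmissibility : S.stub_powerAdmissibility := by
  sorry

theorem stub_unscrewing : S.stub_unscrewing := by
  sorry

theorem stub_coherence : S.stub_coherence := by
  sorry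

theorem stub_separatingTwists : S.stub_separatingTwists := by
  sorry

theorem stub_separation : S.stub_separation := by
  sorry

/-! ## Glue lemmas (proved) -/

section Glue

variable {F₀ F : Type} [Field F₀] [NumberField F₀] [Field F] [NumberField F] [Algebra F₀ F]
  {n : ℕ} {hcpt : isCompact_glFiniteIntegralLevel n F}

omit [NumberField F₀] in
theorem good_union {τ : F ≃ₐ[F₀] F} {π : CuspidalAutomorphicRepData n F hcpt} {ℓ : ℕ}
    {S S' : Set (HeightOneSpectrum (𝓞 F))} {w : HeightOneSpectrum (𝓞 F)}
    (h : Good τ π ℓ S w) (h₁ : w ∉ S') (h₂ : τ • w ∉ S') : Good τ π ℓ (S ∪ S') w := by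
  obtain ⟨g₁, g₂, g₃, g₄, g₅, g₆⟩ := h
  exact ⟨fun hw ↦ hw.elim g₁ h₁, fun hw ↦ hw.elim g₂ h₂, g₃, g₄, g₅, g₆⟩

theorem bounds_of_lt {n p : ℕ} (h : 8 * n ^ 2 + 6 < p) : n < p ∧ 2 * n < p := by
  constructor <;> nlinarith [sq_nonneg n, Nat.zero_le n]

theorem orderOf_ringEquiv_symm {ℓ : ℕ} [Fact ℓ.Prime] (ι : PadicAlgCl ℓ ≃+* ℂ) (x : ℂ) :
    orderOf (ι.symm x) = orderOf x :=
  orderOf_injective (ι.symm : ℂ ≃+* PadicAlgCl ℓ).toRingHom.toMonoidHom ι.symm.injective x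

theorem pow_ne_zero_of_pow_eq_one {c : ℂ} {p k : ℕ} (hp : p ≠ 0) (h : c ^ p = 1) : c ^ k ≠ 0 := by
  apply pow_ne_zero
  rintro rfl
  rw [zero_pow hp] at h
  exact zero_ne_one h

end Glue

/-! ## The composition: stubs ⟹ crux (kernel-checked, no sorry of its own) -/

theorem TwistUnpackaging_of (h₁ : S.stub_auxiliaryTwist) (h₂ : S.stub_powerAdmissibility)
    (h₃ : S.stub_unscrewing) (h₄ : S.stub_coherence) (h₅ : S.stub_separatingTwists)
    (h₆ : S.stub_separation) :
    Summit.Langlands.Langlands.Theses.QuadraticWindow.TwistUnpackaging := by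
  intro F₀ F _ _ _ _ _ τ hTR hdeg hτ n hcpt π e k₀ hreg hpol hpar hodd hnti ℓ _ ι hℓ hunr hfam
  -- the family hypothesis in the vocabulary of this file
  have hfam' : ∀ eψ : FramedGaloisRep F ℂ 1, Admissible τ π ℓ eψ →
      ∃ R : FramedGaloisRep F₀ (PadicAlgCl ℓ) (2 * n), IsPackage π ι eψ R :=
    fun eψ h ↦ hfam eψ h.1 h.2.1 h.2.2
  -- stub 1: the auxiliary prime-order character and its powers
  obtain ⟨p, hp, hNp, S, c, θ, hSfin, hSτ, hcp, hχ, hθ⟩ := h₁ F₀ F τ hdeg hτ ℓ (8 * n ^ 2 + 6)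
  obtain ⟨hnp, h2np⟩ := bounds_of_lt hNp
  -- stub 2: all powers off one residue class are admissible, hence packaged by the family
  obtain ⟨j₀, hj₀, hrob⟩ := h₂ F₀ F τ n hcpt π hnti p hp hnp S c θ hSfin hSτ hcp hχ (fun j ↦ (hθ j).1)
  have hpack : ∀ j : ℕ, j % p ≠ j₀ % p →
      ∃ R : FramedGaloisRep F₀ (PadicAlgCl ℓ) (2 * n), IsPackage π ι (θ j) R :=
    fun j hj ↦ hfam' (θ j) ⟨(hθ j).2.1, (hθ j).2.2, hrob j hj⟩
  -- stub 3: unscrew ρ, ρ' from the packages of the powers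
  obtain ⟨k, ρ, ρ', hk0, hkp, hρss, hρ'ss, hsplit⟩ :=
    h₃ F₀ F τ hdeg hτ n hcpt π ℓ ι p hp hNp S c θ j₀ hSfin hSτ hcp hχ (fun j ↦ (hθ j).1) hj₀ hpack
  refine ⟨ρ, hρss, ?_⟩
  -- stub 5 + family + stub 4: a coherently split separating twist at almost every split place
  have hcθ : ∀ w ∉ S, c w ^ k ≠ 0 := fun w hw ↦ pow_ne_zero_of_pow_eq_one hp.ne_zero (hcp w hw)
  have hsep : ∀ᶠ w in cofinite, τ • w ≠ w → Good τ π ℓ S w →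
      ∃ ζ : PadicAlgCl ℓ, n < orderOf ζ ∧ SplitsAt τ π ι ρ ρ' w ζ := by
    filter_upwards [h₅ F₀ F τ hdeg hτ n hcpt π hnti ℓ S (fun w ↦ c w ^ k) (θ k) hSfin hSτ hcθ
      (hθ k).1 (hθ k).2.1 (hθ k).2.2] with w hw hwτ hgood
    obtain ⟨eψ, eψθ, Sψ, d, hSψfin, hSψτ, hw₁, hw₂, hv, hvθ, hadm, hadmθ, hord⟩ := hw hwτ
    obtain ⟨Rψ, hRψ⟩ := hfam' eψ hadm
    obtain ⟨Rψθ, hRψθ⟩ := hfam' eψθ hadmθ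
    refine ⟨ι.symm (d w / d (τ • w)), ?_, ?_⟩
    · rw [orderOf_ringEquiv_symm]; exact hord
    · exact h₄ F₀ F τ hdeg hτ n hcpt π ℓ ι p hp h2np S c k (θ k) hSfin hSτ hcp hχ hk0 hkp (hθ k).1
        ρ ρ' hρss hρ'ss (fun w' hw' ↦ ⟨(hsplit w' hw').1, (hsplit w' hw').2.1,
          (hsplit w' hw').2.2.2.1, (hsplit w' hw').2.2.2.2⟩)
        eψ eψθ Sψ d Rψ Rψθ hSψfin hSψτ hv hvθ hRψ hRψθ w (good_union hgood hw₁ hw₂)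
  -- stub 6: separation, place by place
  exact h₆ F₀ F τ hdeg hτ n hcpt π ℓ ι S hSfin ρ ρ'
    (fun w hw ↦ ⟨(hsplit w hw).1, (hsplit w hw).2.2.1, (hsplit w hw).2.2.2.1⟩) hsep

/-- The crux from the six stubs (sorries live only inside `stub_*`). -/
theorem TwistUnpackaging_proof : Summit.Langlands.Langlands.Theses.QuadraticWindow.TwistUnpackaging :=
  TwistUnpackaging_of stub_auxiliaryTwist stub_powerAdmissibility stub_unscrewing stub_coherence
    stub_separatingTwists stub_separation

/-! ## Abstract cores (documentation; provers prove stubs 3 and 4 from these + transport) -/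

/-- **The twist annihilator (mass form).**  `Γ` any topological group, `k` an algebraically closed
topological field, `χ : Γ → kˣ` a continuous character with `χ^j ≠ 1` for `0 < j ≤ m`, `X, Y`
continuous semisimple of the SAME dimension `m`.  If `X ⊕ Y⊗χ` and `X⊗χ ⊕ Y` have the same
characteristic polynomials (equivalently are isomorphic, Brauer–Nesbitt), then `X` and `Y` have the
same characteristic polynomials (are isomorphic).  Proof: `(1-χ)([X]-[Y]) = 0` in the Grothendieck
group; the positive and negative parts of `[X]-[Y]` are separately `χ`-stable; a non-zero `χ`-stable
effective class has mass `≥ ord χ > m` (an orbit of size `s` has stabiliser `⟨χ^s⟩` and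
`σ ≅ σ⊗χ^s ⇒ χ^{s·dim σ} = 1`).  The signed-dimension form "(1-χ) is injective on virtual classes of
dimension `< ord χ`" is FALSE (triage CancelToy: `C₅ × C₂`). -/
def TwistCancellation : Prop :=
  ∀ (Γ : Type) [Group Γ] [TopologicalSpace Γ] (k : Type) [Field k] [IsAlgClosed k]
    [TopologicalSpace k] [IsTopologicalRing k] (m : ℕ) (χ : Γ →ₜ* kˣ) (X Y : FramedRep Γ k m),
    X.toContinuousRep.IsSemisimple → Y.toContinuousRep.IsSemisimple →
    (∀ j : ℕ, 0 < j → j ≤ m → χ ^ j ≠ 1) →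
    (∀ g, FramedRep.charpoly X g * FramedRep.charpoly (Y.twist χ) g =
      FramedRep.charpoly (X.twist χ) g * FramedRep.charpoly Y g) →
    ∀ g, FramedRep.charpoly X g = FramedRep.charpoly Y g

/-- **Single-character unscrewing (τ-free abstract core of stub 3).**  `Γ` a topological group,
`𝔉 ⊆ Γ` dense, `k` algebraically closed Hausdorff of characteristic `0`, `χ : Γ → kˣ` continuous of
exact prime order `p > 8d²+6`, `𝔈¹_f, 𝔈²_f` `d`-element multisets of non-zero elements (`f ∈ 𝔉`),
`C_j` (`j` off one residue class `j₀ ≢ 0 mod p`) continuous semisimple of dimension `2d` with roots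
`𝔈¹_f ⊔ χ(f)^j 𝔈²_f` on `𝔉`.  Then for some `0 < kk < p` there are continuous semisimple
`ρ₁, ρ₂` of dimension `d` with `C_0 ≅ ρ₁ ⊕ ρ₂` (characteristic polynomials multiply; the kernel of
`C_0` acts trivially) and `C_kk ≅ ρ₁ ⊕ ρ₂ ⊗ χ^kk` (read on roots). -/
def SingleTwistUnscrewing : Prop :=
  ∀ (Γ : Type) [Group Γ] [TopologicalSpace Γ] [IsTopologicalGroup Γ] (𝔉 : Set Γ), Dense 𝔉 →
  ∀ (k : Type) [Field k] [IsAlgClosed k] [CharZero k] [TopologicalSpace k]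
    [IsTopologicalDivisionRing k] [T2Space k] (d p : ℕ), p.Prime → 8 * d ^ 2 + 6 < p →
  ∀ (χ : Γ →ₜ* kˣ), (∀ g, χ g ^ p = 1) → χ ≠ 1 →
  ∀ (𝔈₁ 𝔈₂ : Γ → Multiset k),
    (∀ f ∈ 𝔉, Multiset.card (𝔈₁ f) = d ∧ Multiset.card (𝔈₂ f) = d ∧
      (0 : k) ∉ 𝔈₁ f ∧ (0 : k) ∉ 𝔈₂ f) →
  ∀ (j₀ : ℕ), ¬ p ∣ j₀ →
  ∀ (C : ℕ → FramedRep Γ k (2 * d)),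
    (∀ j : ℕ, j % p ≠ j₀ % p → (C j).toContinuousRep.IsSemisimple) →
    (∀ j : ℕ, j % p ≠ j₀ % p → ∀ f ∈ 𝔉, (FramedRep.charpoly (C j) f).roots =
      𝔈₁ f + (𝔈₂ f).map (· * (((χ f) ^ j : kˣ) : k))) →
  ∃ (kk : ℕ) (ρ₁ ρ₂ : FramedRep Γ k d), 0 < kk ∧ kk < p ∧
    ρ₁.toContinuousRep.IsSemisimple ∧ ρ₂.toContinuousRep.IsSemisimple ∧
    (∀ g, FramedRep.charpoly (C 0) g = FramedRep.charpoly ρ₁ g * FramedRep.charpoly ρ₂ g) ∧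
    (∀ g, C 0 g = 1 → ρ₁ g = 1 ∧ ρ₂ g = 1) ∧
    (∀ g, (FramedRep.charpoly (C kk) g).roots =
      (FramedRep.charpoly ρ₁ g).roots + (FramedRep.charpoly ρ₂ g).roots.map (· * (((χ g) ^ kk : kˣ) : k)))

end

end Summit.Langlands.Langlands.Cruxes.TwistUnpackaging.TwistAnnihilatorKrullSchmidt
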